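import Summits.NavierStokesRegularity.NavierStokesRegularity.Theorems.ClockStretchingLawClockCeilingLocalisedVorticityFloor
import Summits.NavierStokesRegularity.NavierStokesRegularity.Theorems.ClockStretchingLawClockCeilingStubUniformBounds
import Summits.NavierStokesRegularity.NavierStokesRegularity.Theorems.ClockStretchingLawClockCeilingZoomFrame
import Literature.Analysis.FluidPDE.TypeIAncientMild
import Literature.Analysis.FluidPDE.TaoEnstrophyLocalisation
import HarnessLib

/-!
# Route ClockStretchingLaw, crux `ClockCeiling` (stmt-NavierStokesRegularity-10570) — the
# Gaussian-weighted enstrophy (vorticity clock) of a singular Type-I model is bounded below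

Portrait clause for the crux's Type-I class `𝒦_C` (`IsTypeIAncientMild C u`: jointly smooth on
`(−∞,0) × ℝ³`, divergence-free, KNSS/Oseen-mild, `‖u(t,x)‖ ≤ C/√(−t)`, with the scale-invariant
local energies `A, E ≤ C`), upgrading the localised vorticity floor `localisedVorticityFloor`
(p160189) with the class-uniform KNSS bounds `uniformBounds_exists_mixed` (p147526):

**`stub_gaussianEnstrophyFloor`.** `∀ C ∃ η > 0`: every `u ∈ 𝒦_C` singular at the space–time
origin has, at EVERY `t < 0`,
`√(−t) ∫ ‖ω(t,x)‖² e^{−‖x‖²/(4(−t))} dx ≥ η`.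

## Proof

Direct, no compactness. `localisedVorticityFloor C` gives `η₁ > 0`, `R > 0` and, for each `t < 0`,
a point `x₀` with `‖x₀‖ < R√(−t)` and `(−t)‖ω(t,x₀)‖ ≥ η₁`. The Hessian bound
`‖∇²u(t)‖ ≤ K(C)(−t)^{−3/2}` (`uniformBounds_exists_mixed 2 0`) and `ω = curlCLM ∘ ∇u` make
`ω(t, ·)` Lipschitz with constant `‖curlCLM‖ K(C) (−t)^{−3/2}` (mean value inequality), so on the
ball `B(x₀, ρ√(−t))`, `ρ = η₁ / (2(‖curlCLM‖ |K(C)| + 1))`, still `(−t)‖ω(t,x)‖ ≥ η₁/2`, while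
`‖x‖ < (R + ρ)√(−t)` keeps the Gaussian weight `≥ e^{−(R+ρ)²/4}`. The integrand is nonnegative and
integrable (`‖ω‖ ≤ ‖curlCLM‖ ‖∇u‖ ≤ ‖curlCLM‖ K₁(C)(−t)⁻¹` by `uniformBounds_exists_mixed 1 0`, times
the integrable Gaussian `integrable_frameWeight`), so the whole-space integral dominates the
integral over the ball, which is at least `(η₁/(2(−t)))² e^{−(R+ρ)²/4} |B₁| ρ³ (−t)^{3/2}`; all
powers of `(−t)` cancel against the prefactor `√(−t)`:
`η = (η₁/2)² e^{−(R+ρ)²/4} ρ³ |B₁|`.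

## References

* G. Koch, N. Nadirashvili, G. Seregin, V. Šverák, *Liouville theorems for the Navier–Stokes
  equations and applications*, Acta Math. 203 (2009) 83–105, Prop. 4.1, Lemma 3.1, Remark 6.1
  (arXiv:0709.3599). [KochNadirashviliSereginSverak2009]
* D. Albritton, T. Barker, ARMA 232 (2019), Lemma 2.2 and Prop. 2.3 (arXiv:1811.00502).
  [AlbrittonBarker2019]
-/

noncomputable section

-- the summit and its single sub-problem share the name (CONVENTIONS §1), as in every Theorems file
set_option linter.dupNamespace false

open MeasureTheory Filter Topology Set Metric Function
open scoped NNReal ENNReal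

namespace Summit.NavierStokesRegularity.NavierStokesRegularity.Theorems

open Literature.Analysis Literature.Analysis.FluidPDE

section Helpers

variable {C : ℝ} {u : ℝ → EuclideanSpace ℝ (Fin 3) → EuclideanSpace ℝ (Fin 3)}

/-- The vorticity slice `curl u(t, ·)` of a Type-I ancient mild field is continuous at every
`t < 0` (`curl = curlCLM ∘ ∇`, smooth slices). [folklore] -/
theorem gaussEnstrophy_continuous_curl (hu : IsTypeIAncientMild C u) {t : ℝ} (ht : t < 0) :
    Continuous (curl (u t)) := by
  rw [curl_eq_curlCLM_comp]
  exact curlCLM.continuous.comp ((hu.contDiff_slice ht).continuous_fderiv (by simp))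

/-- **Lipschitz bound for the vorticity slice from a Hessian bound** (mean value inequality for
`curl u(t, ·) = curlCLM ∘ ∇u(t, ·)`): if `‖∇²u(t, x)‖ ≤ M` everywhere, then
`‖curl u(t,x) − curl u(t,y)‖ ≤ ‖curlCLM‖ M ‖x − y‖`. [folklore] -/
theorem gaussEnstrophy_norm_curl_sub_le (hu : IsTypeIAncientMild C u) {t : ℝ} (ht : t < 0)
    {M : ℝ} (hM : ∀ x, ‖iteratedFDeriv ℝ 2 (u t) x‖ ≤ M) (x y : EuclideanSpace ℝ (Fin 3)) :
    ‖curl (u t) x - curl (u t) y‖ ≤ ‖curlCLM‖ * M * ‖x - y‖ := by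
  have h2 : ContDiff ℝ 2 (u t) := contDiff_infty.1 (hu.contDiff_slice ht) 2
  have hd : Differentiable ℝ (fderiv ℝ (u t)) :=
    (h2.fderiv_right (m := 1) (by norm_num)).differentiable one_ne_zero
  have hdiff : ∀ z ∈ (univ : Set (EuclideanSpace ℝ (Fin 3))),
      DifferentiableAt ℝ (curl (u t)) z := fun z _ => by
    rw [curl_eq_curlCLM_comp]
    exact curlCLM.differentiableAt.comp z (hd z)
  have hbound : ∀ z ∈ (univ : Set (EuclideanSpace ℝ (Fin 3))),
      ‖fderiv ℝ (curl (u t)) z‖ ≤ ‖curlCLM‖ * M := fun z _ =>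
    (norm_fderiv_curl_le h2 z).trans
      (mul_le_mul_of_nonneg_left (hM z) (ContinuousLinearMap.opNorm_nonneg curlCLM))
  exact convex_univ.norm_image_sub_le_of_norm_fderiv_le hdiff hbound (mem_univ y) (mem_univ x)

/-- **Integrability of the Gaussian-weighted enstrophy density** of a Type-I ancient mild field
with bounded gradient slice: `‖curl u(t,x)‖² e^{−‖x‖²/(4(−t))}` is a bounded continuous function
(`‖curl u‖ ≤ ‖curlCLM‖ ‖∇u‖ ≤ ‖curlCLM‖ M`) times the integrable Gaussian weight
(`integrable_frameWeight`). [folklore] -/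
theorem gaussEnstrophy_integrable (hu : IsTypeIAncientMild C u) {t : ℝ} (ht : t < 0) {M : ℝ}
    (hM : ∀ x, ‖fderiv ℝ (u t) x‖ ≤ M) :
    Integrable fun x : EuclideanSpace ℝ (Fin 3) =>
      ‖curl (u t) x‖ ^ 2 * Real.exp (-(‖x‖ ^ 2) / (4 * (-t))) := by
  refine (integrable_frameWeight ht).bdd_mul (c := (‖curlCLM‖ * M) ^ 2)
    ((gaussEnstrophy_continuous_curl hu ht).norm.pow 2).aestronglyMeasurable
    (Eventually.of_forall fun x => ?_)
  rw [Real.norm_of_nonneg (sq_nonneg _)]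
  exact pow_le_pow_left₀ (norm_nonneg _)
    ((norm_curl_le _ x).trans
      (mul_le_mul_of_nonneg_left (hM x) (ContinuousLinearMap.opNorm_nonneg curlCLM))) 2

/-- Scaling bookkeeping: `(−t) · (−t)^{−3/2} · √(−t) = 1` for `t < 0`. [folklore] -/
theorem gaussEnstrophy_scale_cancel {t : ℝ} (ht : t < 0) :
    (-t) * (-t) ^ (-(3 : ℝ) / 2) * Real.sqrt (-t) = 1 := by
  have hnt : 0 < -t := neg_pos.2 ht
  rw [Real.sqrt_eq_rpow]
  conv_lhs => rw [show (-t) * (-t) ^ (-(3 : ℝ) / 2) = (-t) ^ (1 : ℝ) * (-t) ^ (-(3 : ℝ) / 2) by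
    rw [Real.rpow_one]]
  rw [← Real.rpow_add hnt, ← Real.rpow_add hnt]
  norm_num

end Helpers

/-- **Stub `stub_gaussianEnstrophyFloor` (crux stmt-NavierStokesRegularity-10570, line `registered`,
portrait clause): the Gaussian-weighted enstrophy (vorticity clock) floor of a singular Type-I
model.** For every `C` there is `η > 0` such that every `u ∈ 𝒦_C` (`IsTypeIAncientMild C u` with
the scale-invariant energy ledger `A, E ≤ C`) singular at the space–time origin has, at every
`t < 0`, `√(−t) ∫ ‖curl u(t,x)‖² e^{−‖x‖²/(4(−t))} dx ≥ η`. The localised floor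
`localisedVorticityFloor` spread over a ball of radius `ρ√(−t)` by the Lipschitz bound of the
vorticity slice (`gaussEnstrophy_norm_curl_sub_le` with the class Hessian bound
`uniformBounds_exists_mixed 2 0`), integrated against the Gaussian weight; every power of `−t`
cancels. [cite: KochNadirashviliSereginSverak2009, Prop. 4.1, Lemma 3.1 and Remark 6.1 (arXiv:0709.3599)] -/
theorem stub_gaussianEnstrophyFloor : ∀ C : ℝ, ∃ η > 0, ∀ u : ℝ → EuclideanSpace ℝ (Fin 3) → EuclideanSpace ℝ (Fin 3), Literature.Analysis.FluidPDE.IsTypeIAncientMild C u → (∀ (x₀ : EuclideanSpace ℝ (Fin 3)) (t₀ r : ℝ), t₀ ≤ 0 → 0 < r → (∀ t, t₀ - r ^ 2 < t → t < t₀ → r⁻¹ * ∫ x in Metric.ball x₀ r, ‖u t x‖ ^ 2 ≤ C) ∧ r⁻¹ * ∫ t in Set.Ioo (t₀ - r ^ 2) t₀, ∫ x in Metric.ball x₀ r, ‖fderiv ℝ (u t) x‖ ^ 2 ≤ C) → (∀ r > 0, ∀ M : ℝ, ∃ t ∈ Set.Ioo (-(r ^ 2)) (0 : ℝ), ∃ x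 ∈ Metric.ball (0 : EuclideanSpace ℝ (Fin 3)) r, M < ‖u t x‖) → ∀ t < 0, η ≤ Real.sqrt (-t) * ∫ x, ‖Literature.Analysis.FluidPDE.curl (u t) x‖ ^ 2 * Real.exp (-(‖x‖ ^ 2) / (4 * (-t))) := by
  intro C
  obtain ⟨η₁, hη₁, R, hR, hfloor⟩ := localisedVorticityFloor C
  obtain ⟨K, hK0, hK⟩ := uniformBounds_exists_mixed 2 0 (-(3 : ℝ) / 2) (by norm_num)
  obtain ⟨K₁, -, hK₁⟩ := uniformBounds_exists_mixed 1 0 (-(1 : ℝ)) (by norm_num)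
  -- the constants, depending on `C` only
  set κ : ℝ := ‖curlCLM‖ with hκ
  have hκ0 : 0 ≤ κ := ContinuousLinearMap.opNorm_nonneg curlCLM
  set A : ℝ := κ * |K C| + 1 with hA
  have hApos : 0 < A := by positivity
  set ρ : ℝ := η₁ / (2 * A) with hρ
  have hρpos : 0 < ρ := by positivity
  set g : ℝ := Real.exp (-((R + ρ) ^ 2) / 4) with hg
  have hgpos : 0 < g := Real.exp_pos _
  set V : ℝ := volume.real (Metric.ball (0 : EuclideanSpace ℝ (Fin 3)) 1) with hV
  have hVpos : 0 < V := by
    rw [hV, measureReal_def]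
    exact ENNReal.toReal_pos (measure_ball_pos volume _ one_pos).ne' measure_ball_lt_top.ne
  refine ⟨(η₁ / 2) ^ 2 * g * (ρ ^ 3 * V), by positivity, ?_⟩
  intro u hu hE hsing t ht
  have hC : 0 ≤ C := hu.nonneg
  have hKC : 0 ≤ K C := hK0 C hC
  have hnt : 0 < -t := neg_pos.2 ht
  -- the point of the localised floor
  obtain ⟨x₀, hx₀, hηx₀⟩ := hfloor u hu hE hsing t ht
  rw [mem_ball_zero_iff] at hx₀
  set s : ℝ := Real.sqrt (-t) with hs
  have hspos : 0 < s := Real.sqrt_pos.2 hnt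
  have hs0 : s ≠ 0 := hspos.ne'
  have hs2 : s ^ 2 = -t := Real.sq_sqrt hnt.le
  -- the class bounds at time `t`
  have hK2 : ∀ x, ‖iteratedFDeriv ℝ 2 (u t) x‖ ≤ K C * (-t) ^ (-(3 : ℝ) / 2) := fun x => by
    simpa only [iteratedDeriv_zero] using hK C u hu t ht x
  have hK1 : ∀ x, ‖fderiv ℝ (u t) x‖ ≤ K₁ C * (-t) ^ (-(1 : ℝ)) := fun x => by
    simpa only [iteratedDeriv_zero, norm_iteratedFDeriv_one] using hK₁ C u hu t ht x
  have hscale : (-t) * (-t) ^ (-(3 : ℝ) / 2) * s = 1 := by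
    rw [hs]; exact gaussEnstrophy_scale_cancel ht
  -- Lipschitz smallness of the radius: `κ K(C) ρ ≤ η₁ / 2`
  have hsmall : κ * K C * ρ ≤ η₁ / 2 := by
    have hKA : κ * K C ≤ A := by rw [hA, abs_of_nonneg hKC]; linarith
    calc κ * K C * ρ ≤ A * ρ := mul_le_mul_of_nonneg_right hKA hρpos.le
      _ = η₁ / 2 := by rw [hρ]; field_simp
  -- the floor persists on the ball `B(x₀, ρ s)`
  have hfloorB : ∀ x ∈ ball x₀ (ρ * s), η₁ / 2 ≤ (-t) * ‖curl (u t) x‖ := by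
    intro x hx
    rw [mem_ball_iff_norm] at hx
    have h1 : ‖curl (u t) x₀‖ - ‖curl (u t) x‖ ≤
        κ * (K C * (-t) ^ (-(3 : ℝ) / 2)) * ‖x₀ - x‖ :=
      (norm_sub_norm_le _ _).trans (gaussEnstrophy_norm_curl_sub_le hu ht hK2 x₀ x)
    have h2 : (-t) * (κ * (K C * (-t) ^ (-(3 : ℝ) / 2)) * ‖x₀ - x‖) ≤ κ * K C * ρ := by
      rw [norm_sub_rev]
      have hcoef : 0 ≤ κ * K C * ((-t) * (-t) ^ (-(3 : ℝ) / 2)) :=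
        mul_nonneg (mul_nonneg hκ0 hKC) (mul_nonneg hnt.le (Real.rpow_nonneg hnt.le _))
      calc (-t) * (κ * (K C * (-t) ^ (-(3 : ℝ) / 2)) * ‖x - x₀‖)
          = κ * K C * ((-t) * (-t) ^ (-(3 : ℝ) / 2)) * ‖x - x₀‖ := by ring
        _ ≤ κ * K C * ((-t) * (-t) ^ (-(3 : ℝ) / 2)) * (ρ * s) :=
            mul_le_mul_of_nonneg_left hx.le hcoef
        _ = κ * K C * ρ * ((-t) * (-t) ^ (-(3 : ℝ) / 2) * s) := by ring
        _ = κ * K C * ρ := by rw [hscale, mul_one]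
    have h3 : (-t) * ‖curl (u t) x₀‖ - (-t) * ‖curl (u t) x‖ ≤
        (-t) * (κ * (K C * (-t) ^ (-(3 : ℝ) / 2)) * ‖x₀ - x‖) := by
      rw [← mul_sub]; exact mul_le_mul_of_nonneg_left h1 hnt.le
    linarith
  -- pointwise lower bound of the integrand on the ball
  set F : EuclideanSpace ℝ (Fin 3) → ℝ := fun x =>
    ‖curl (u t) x‖ ^ 2 * Real.exp (-(‖x‖ ^ 2) / (4 * (-t))) with hF
  have hFB : ∀ x ∈ ball x₀ (ρ * s), (η₁ / (2 * (-t))) ^ 2 * g ≤ F x := by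
    intro x hx
    have hfl := hfloorB x hx
    rw [mem_ball_iff_norm] at hx
    have h2t : 0 < 2 * (-t) := mul_pos two_pos hnt
    have hc : η₁ / (2 * (-t)) ≤ ‖curl (u t) x‖ := by
      rw [div_le_iff₀ h2t]; linarith
    have hxn : ‖x‖ ≤ (R + ρ) * s := by
      have : ‖x‖ ≤ ‖x - x₀‖ + ‖x₀‖ := by
        calc ‖x‖ = ‖(x - x₀) + x₀‖ := by rw [sub_add_cancel]
          _ ≤ ‖x - x₀‖ + ‖x₀‖ := norm_add_le _ _
      linarith
    have hw : -((R + ρ) ^ 2) / 4 ≤ -(‖x‖ ^ 2) / (4 * (-t)) := by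
      rw [div_le_div_iff₀ (by norm_num) (mul_pos (by norm_num) hnt)]
      have hx2 : ‖x‖ ^ 2 ≤ ((R + ρ) * s) ^ 2 := pow_le_pow_left₀ (norm_nonneg _) hxn 2
      rw [mul_pow, hs2] at hx2
      linarith
    show (η₁ / (2 * (-t))) ^ 2 * g ≤ ‖curl (u t) x‖ ^ 2 * Real.exp (-(‖x‖ ^ 2) / (4 * (-t)))
    exact mul_le_mul (pow_le_pow_left₀ (div_nonneg hη₁.le h2t.le) hc 2) (Real.exp_le_exp.2 hw)
      hgpos.le (sq_nonneg _)
  -- integration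
  have hF_int : Integrable F volume := gaussEnstrophy_integrable hu ht hK1
  have hF_nn : 0 ≤ᵐ[volume] F :=
    Eventually.of_forall fun x => mul_nonneg (sq_nonneg _) (Real.exp_pos _).le
  have hB_meas : MeasurableSet (ball x₀ (ρ * s)) := measurableSet_ball
  have hB_fin : volume (ball x₀ (ρ * s)) ≠ ∞ := measure_ball_lt_top.ne
  have hvol : volume.real (ball x₀ (ρ * s)) = (ρ * s) ^ 3 * V := by
    rw [measureReal_def, Measure.addHaar_ball_of_pos volume x₀ (mul_pos hρpos hspos),
      finrank_euclideanSpace_fin, ENNReal.toReal_mul, ENNReal.toReal_ofReal (by positivity), hV,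
      measureReal_def]
  have hlow : (η₁ / (2 * (-t))) ^ 2 * g * ((ρ * s) ^ 3 * V) ≤ ∫ x, F x :=
    calc (η₁ / (2 * (-t))) ^ 2 * g * ((ρ * s) ^ 3 * V)
        = (η₁ / (2 * (-t))) ^ 2 * g * volume.real (ball x₀ (ρ * s)) := by rw [hvol]
      _ ≤ ∫ x in ball x₀ (ρ * s), F x :=
          setIntegral_ge_of_const_le_real hB_meas hB_fin hFB hF_int.integrableOn
      _ ≤ ∫ x, F x := setIntegral_le_integral hF_int hF_nn
  calc (η₁ / 2) ^ 2 * g * (ρ ^ 3 * V)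
      = s * ((η₁ / (2 * (-t))) ^ 2 * g * ((ρ * s) ^ 3 * V)) := by
        rw [← hs2]; field_simp
    _ ≤ s * ∫ x, F x := mul_le_mul_of_nonneg_left hlow hspos.le

end Summit.NavierStokesRegularity.NavierStokesRegularity.Theorems

end
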